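import Summits.AtomisticToContinuum.Crystallization.Theses.TwoCentreKissingKernel

/-!
# Route `TwoCentreKissingKernel`, item stmt-AtomisticToContinuum-12081 `SoftTwoCentreFourCommon` — helpers

Two structural lemmas about the soft two-centre lemma (tolerance `η ∈ [0, 10⁻³]`):

* `twoCentreFourCommon_of_softTwoCentreFourCommon` : the `η = 0` section of
  `SoftTwoCentreFourCommon` is literally the crux `TwoCentreFourCommon`
  (Flatley–Theil 2015, Conjecture 2.2): in a `1`-separated set, "`w ≠ z ∧ dist w z ≤ 1`" and
  "`dist w z = 1`" are the same predicate.  So the support item is at least as strong as the crux.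
* `softTwoCentreFourCommon_of_finite` : reduction of the item to FINITE configurations of at most
  `24` points all lying within `1 + η` of one of the two centres (the two soft shells and nothing
  else): the union `N(z) ∪ N(z')` of the two twelve-point soft neighbourhoods is a finite set
  containing `z`, `z'` and every common neighbour, and the three counts are unchanged when `Z` is
  replaced by it.  This is the input format of any certificate (interval / SDP) attack on the item.

No new definitions; nothing here proves the item itself (an open problem in print at `η = 0`).
-/

namespace Summit.AtomisticToContinuum.Crystallization.Theorems

open Summit.AtomisticToContinuum.Crystallization.Theses.TwoCentreKissingKernel

open scoped Classical

/-- The `η = 0` section of the soft two-centre lemma is Flatley–Theil's Conjecture 2.2: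
`SoftTwoCentreFourCommon → TwoCentreFourCommon`.  In a `1`-separated set `Z`, for `w ∈ Z` the
conditions `w ≠ z ∧ dist w z ≤ 1 + 0` and `dist w z = 1` coincide, so the three neighbour sets of
the two statements are equal and `z ≠ z'` follows from `dist z z' = 1`. -/
theorem twoCentreFourCommon_of_softTwoCentreFourCommon (h : SoftTwoCentreFourCommon) :
    TwoCentreFourCommon := by
  intro Z hsep z hz z' hz' hd hN hN'
  have hsep' : ∀ x ∈ Z, ∀ y ∈ Z, x ≠ y → 1 - (0 : ℝ) ≤ dist x y := by
    simpa only [sub_zero] using hsep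
  have hne : z ≠ z' := by
    intro hzz
    rw [hzz, dist_self] at hd
    exact zero_ne_one hd
  have hd' : dist z z' ≤ 1 + 0 := by rw [add_zero, hd]
  -- the neighbour sets coincide
  have key : ∀ u ∈ Z, ∀ w ∈ Z, (w ≠ u ∧ dist w u ≤ 1 + 0) ↔ dist w u = 1 := by
    intro u hu w hw
    rw [add_zero]
    constructor
    · rintro ⟨hwu, hle⟩
      exact le_antisymm hle (hsep w hw u hu hwu)
    · intro heq
      refine ⟨?_, heq.le⟩
      intro hwu
      rw [hwu, dist_self] at heq
      exact zero_ne_one heq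
  have e1 : {w ∈ Z | w ≠ z ∧ dist w z ≤ 1 + 0} = {w ∈ Z | dist w z = 1} := by
    ext w
    simp only [Set.mem_setOf_eq]
    constructor
    · rintro ⟨hw, hr⟩; exact ⟨hw, (key z hz w hw).1 hr⟩
    · rintro ⟨hw, hr⟩; exact ⟨hw, (key z hz w hw).2 hr⟩
  have e2 : {w ∈ Z | w ≠ z' ∧ dist w z' ≤ 1 + 0} = {w ∈ Z | dist w z' = 1} := by
    ext w
    simp only [Set.mem_setOf_eq]
    constructor
    · rintro ⟨hw, hr⟩; exact ⟨hw, (key z' hz' w hw).1 hr⟩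
    · rintro ⟨hw, hr⟩; exact ⟨hw, (key z' hz' w hw).2 hr⟩
  have e3 : {w ∈ Z | w ≠ z ∧ w ≠ z' ∧ dist w z ≤ 1 + 0 ∧ dist w z' ≤ 1 + 0} =
      {w ∈ Z | dist w z = 1 ∧ dist w z' = 1} := by
    ext w
    simp only [Set.mem_setOf_eq]
    constructor
    · rintro ⟨hw, h1, h2, h3, h4⟩
      exact ⟨hw, (key z hz w hw).1 ⟨h1, h3⟩, (key z' hz' w hw).1 ⟨h2, h4⟩⟩
    · rintro ⟨hw, h1, h2⟩
      exact ⟨hw, ((key z hz w hw).2 h1).1, ((key z' hz' w hw).2 h2).1, ((key z hz w hw).2 h1).2,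
        ((key z' hz' w hw).2 h2).2⟩
  have := h 0 le_rfl (by norm_num) Z hsep' z hz z' hz' hne hd' (by rw [e1]; exact hN)
    (by rw [e2]; exact hN')
  rw [e3] at this
  exact this

/-- **Finite reduction of `SoftTwoCentreFourCommon`.**  It suffices to prove the soft two-centre
lemma for finite configurations `F` of at most `24` points every one of which lies within `1 + η`
of `z` or of `z'` (stated with `Finset.filter` counts).  Proof: given `Z`, the soft neighbourhoods
`N(z) = {w ∈ Z | w ≠ z ∧ dist w z ≤ 1+η}` and `N(z')` have `ncard = 12`, hence are finite; the finite
set `F = N(z) ∪ N(z')` contains `z` (a soft neighbour of `z'`) and `z'`, inherits `(1-η)`-separation,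
has at most `24` points, and its three neighbour counts relative to `z, z'` equal those of `Z`. -/
theorem softTwoCentreFourCommon_of_finite
    (H : ∀ η : ℝ, 0 ≤ η → η ≤ 1 / 1000 → ∀ F : Finset (EuclideanSpace ℝ (Fin 3)),
      F.card ≤ 24 →
      (∀ x ∈ F, ∀ y ∈ F, x ≠ y → 1 - η ≤ dist x y) →
      ∀ z ∈ F, ∀ z' ∈ F, z ≠ z' → dist z z' ≤ 1 + η →
      (∀ w ∈ F, dist w z ≤ 1 + η ∨ dist w z' ≤ 1 + η) →
      (F.filter (fun w => w ≠ z ∧ dist w z ≤ 1 + η)).card = 12 →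
      (F.filter (fun w => w ≠ z' ∧ dist w z' ≤ 1 + η)).card = 12 →
      4 ≤ (F.filter (fun w => w ≠ z ∧ w ≠ z' ∧ dist w z ≤ 1 + η ∧ dist w z' ≤ 1 + η)).card) :
    SoftTwoCentreFourCommon := by
  intro η hη hη1 Z hsep z hz z' hz' hne hd hN hN'
  set Nz : Set (EuclideanSpace ℝ (Fin 3)) := {w ∈ Z | w ≠ z ∧ dist w z ≤ 1 + η} with hNz
  set Nz' : Set (EuclideanSpace ℝ (Fin 3)) := {w ∈ Z | w ≠ z' ∧ dist w z' ≤ 1 + η} with hNz'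
  have hfin : Nz.Finite := Set.finite_of_ncard_ne_zero (by rw [hN]; norm_num)
  have hfin' : Nz'.Finite := Set.finite_of_ncard_ne_zero (by rw [hN']; norm_num)
  have hSfin : (Nz ∪ Nz').Finite := hfin.union hfin'
  set F : Finset (EuclideanSpace ℝ (Fin 3)) := hSfin.toFinset with hF
  -- membership in F
  have memF : ∀ w, w ∈ F ↔ w ∈ Z ∧ (dist w z ≤ 1 + η ∨ dist w z' ≤ 1 + η) := by
    intro w
    rw [hF, Set.Finite.mem_toFinset, Set.mem_union]
    constructor
    · rintro (⟨hw, -, h1⟩ | ⟨hw, -, h1⟩)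
      · exact ⟨hw, Or.inl h1⟩
      · exact ⟨hw, Or.inr h1⟩
    · rintro ⟨hw, h1 | h1⟩
      · by_cases hwz : w = z
        · right
          refine ⟨hw, ?_, ?_⟩
          · rw [hwz]; exact hne
          · rw [hwz]; exact hd
        · left; exact ⟨hw, hwz, h1⟩
      · by_cases hwz' : w = z'
        · left
          refine ⟨hw, ?_, ?_⟩
          · rw [hwz']; exact hne.symm
          · rw [hwz', dist_comm]; exact hd
        · right; exact ⟨hw, hwz', h1⟩
  have hzF : z ∈ F := (memF z).2 ⟨hz, Or.inl (by rw [dist_self]; linarith)⟩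
  have hz'F : z' ∈ F := (memF z').2 ⟨hz', Or.inr (by rw [dist_self]; linarith)⟩
  have hcard : F.card ≤ 24 := by
    have h1 : F.card = (Nz ∪ Nz').ncard := (Set.ncard_eq_toFinset_card (Nz ∪ Nz') hSfin).symm
    have h2 : (Nz ∪ Nz').ncard ≤ Nz.ncard + Nz'.ncard := Set.ncard_union_le Nz Nz'
    rw [h1]
    rw [hN, hN'] at h2
    exact h2
  have hsepF : ∀ x ∈ F, ∀ y ∈ F, x ≠ y → 1 - η ≤ dist x y := by
    intro x hx y hy hxy
    exact hsep x ((memF x).1 hx).1 y ((memF y).1 hy).1 hxy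
  have hloc : ∀ w ∈ F, dist w z ≤ 1 + η ∨ dist w z' ≤ 1 + η := fun w hw => ((memF w).1 hw).2
  -- the three counts
  have c1 : ((F.filter (fun w => w ≠ z ∧ dist w z ≤ 1 + η) : Finset _) : Set _) = Nz := by
    ext w
    simp only [Finset.coe_filter, Set.mem_setOf_eq, memF]
    constructor
    · rintro ⟨⟨hw, -⟩, h1, h2⟩; exact ⟨hw, h1, h2⟩
    · rintro ⟨hw, h1, h2⟩; exact ⟨⟨hw, Or.inl h2⟩, h1, h2⟩
  have c2 : ((F.filter (fun w => w ≠ z' ∧ dist w z' ≤ 1 + η) : Finset _) : Set _) = Nz' := by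
    ext w
    simp only [Finset.coe_filter, Set.mem_setOf_eq, memF]
    constructor
    · rintro ⟨⟨hw, -⟩, h1, h2⟩; exact ⟨hw, h1, h2⟩
    · rintro ⟨hw, h1, h2⟩; exact ⟨⟨hw, Or.inr h2⟩, h1, h2⟩
  have c3 : ((F.filter (fun w => w ≠ z ∧ w ≠ z' ∧ dist w z ≤ 1 + η ∧ dist w z' ≤ 1 + η) :
      Finset _) : Set _) = {w ∈ Z | w ≠ z ∧ w ≠ z' ∧ dist w z ≤ 1 + η ∧ dist w z' ≤ 1 + η} := by
    ext w
    simp only [Finset.coe_filter, Set.mem_setOf_eq, memF]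
    constructor
    · rintro ⟨⟨hw, -⟩, hr⟩; exact ⟨hw, hr⟩
    · rintro ⟨hw, h1, h2, h3, h4⟩; exact ⟨⟨hw, Or.inl h3⟩, h1, h2, h3, h4⟩
  have k1 : (F.filter (fun w => w ≠ z ∧ dist w z ≤ 1 + η)).card = 12 := by
    rw [← Set.ncard_coe_finset, c1]; exact hN
  have k2 : (F.filter (fun w => w ≠ z' ∧ dist w z' ≤ 1 + η)).card = 12 := by
    rw [← Set.ncard_coe_finset, c2]; exact hN'
  have := H η hη hη1 F hcard hsepF z hzF z' hz'F hne hd hloc k1 k2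
  rw [← Set.ncard_coe_finset, c3] at this
  exact this

/-! ## Dimer form of the item

"`≥ 4` soft-common neighbours" is, by inclusion–exclusion on the two eleven-point exclusive shells,
the same as "at most `18` further balls on the twelve–twelve dimer"
(`softTwoCentre_common_add_dimer_eq`, `softTwoCentreFourCommon_iff_dimer`); hence the item follows
from the hypothesis-free soft dimer-kissing bound (`softTwoCentreFourCommon_of_dimerKissing`) and
from its nineteen-point finite form (`softTwoCentreFourCommon_of_no_nineteen`), the natural input
format of an infeasibility certificate.  Nothing here proves the item. -/

/-- **Counting identity behind the dimer reading of the two-centre lemma.**  If `z ≠ z'` are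
within `1 + η` of each other and each has exactly twelve other points of `Z` within `1 + η`, then
(number of soft-common neighbours) + (number of further points within `1 + η` of `z` or of `z'`)
`= 22`: writing `A' = N(z) \ {z'}` and `B' = N(z') \ {z}` (eleven points each), the common
neighbours are `A' ∩ B'` and the further balls on the dimer are `A' ∪ B'`.  No separation
hypothesis is needed. -/
theorem softTwoCentre_common_add_dimer_eq
    {η : ℝ} {Z : Set (EuclideanSpace ℝ (Fin 3))} {z z' : EuclideanSpace ℝ (Fin 3)}
    (hz : z ∈ Z) (hz' : z' ∈ Z) (hne : z ≠ z') (hd : dist z z' ≤ 1 + η)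
    (hN : {w ∈ Z | w ≠ z ∧ dist w z ≤ 1 + η}.ncard = 12)
    (hN' : {w ∈ Z | w ≠ z' ∧ dist w z' ≤ 1 + η}.ncard = 12) :
    {w ∈ Z | w ≠ z ∧ w ≠ z' ∧ dist w z ≤ 1 + η ∧ dist w z' ≤ 1 + η}.ncard +
      {w ∈ Z | w ≠ z ∧ w ≠ z' ∧ (dist w z ≤ 1 + η ∨ dist w z' ≤ 1 + η)}.ncard = 22 := by
  set A : Set (EuclideanSpace ℝ (Fin 3)) := {w ∈ Z | w ≠ z ∧ dist w z ≤ 1 + η} with hA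
  set B : Set (EuclideanSpace ℝ (Fin 3)) := {w ∈ Z | w ≠ z' ∧ dist w z' ≤ 1 + η} with hB
  have hAfin : A.Finite := Set.finite_of_ncard_ne_zero (by rw [hN]; norm_num)
  have hBfin : B.Finite := Set.finite_of_ncard_ne_zero (by rw [hN']; norm_num)
  set A' : Set (EuclideanSpace ℝ (Fin 3)) := {w ∈ Z | w ≠ z ∧ w ≠ z' ∧ dist w z ≤ 1 + η}
    with hA'
  set B' : Set (EuclideanSpace ℝ (Fin 3)) := {w ∈ Z | w ≠ z ∧ w ≠ z' ∧ dist w z' ≤ 1 + η}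
    with hB'
  have hz'A : z' ∈ A := ⟨hz', hne.symm, by rwa [dist_comm]⟩
  have hzB : z ∈ B := ⟨hz, hne, hd⟩
  have eA : A' = A \ {z'} := by
    ext w
    simp only [hA', hA, Set.mem_sdiff, Set.mem_setOf_eq, Set.mem_singleton_iff]
    tauto
  have eB : B' = B \ {z} := by
    ext w
    simp only [hB', hB, Set.mem_sdiff, Set.mem_setOf_eq, Set.mem_singleton_iff]
    tauto
  have hA'card : A'.ncard = 11 := by
    rw [eA, Set.ncard_sdiff_singleton_of_mem hz'A, hN]
  have hB'card : B'.ncard = 11 := by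
    rw [eB, Set.ncard_sdiff_singleton_of_mem hzB, hN']
  have hA'fin : A'.Finite := by rw [eA]; exact hAfin.sdiff
  have hB'fin : B'.Finite := by rw [eB]; exact hBfin.sdiff
  have eC : {w ∈ Z | w ≠ z ∧ w ≠ z' ∧ dist w z ≤ 1 + η ∧ dist w z' ≤ 1 + η} = A' ∩ B' := by
    ext w
    simp only [hA', hB', Set.mem_inter_iff, Set.mem_setOf_eq]
    tauto
  have eU : {w ∈ Z | w ≠ z ∧ w ≠ z' ∧ (dist w z ≤ 1 + η ∨ dist w z' ≤ 1 + η)} = A' ∪ B' := by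
    ext w
    simp only [hA', hB', Set.mem_union, Set.mem_setOf_eq]
    tauto
  rw [eC, eU, add_comm, Set.ncard_union_add_ncard_inter A' B' hA'fin hB'fin, hA'card, hB'card]

/-- **Dimer form of `SoftTwoCentreFourCommon`.**  The soft two-centre lemma is equivalent to:
under the same hypotheses (tolerance `η ∈ [0, 10⁻³]`, `Z` `(1-η)`-separated, `z ≠ z'` within
`1 + η`, both exactly twelve-coordinated within `1 + η`), at most `18` further points of `Z` lie
within `1 + η` of `z` or of `z'` ("at most 18 further balls touch a twelve–twelve dimer").
Immediate from `softTwoCentre_common_add_dimer_eq` (`common + dimer = 22`). -/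
theorem softTwoCentreFourCommon_iff_dimer :
    SoftTwoCentreFourCommon ↔
    ∀ η : ℝ, 0 ≤ η → η ≤ 1 / 1000 → ∀ Z : Set (EuclideanSpace ℝ (Fin 3)),
      (∀ x ∈ Z, ∀ y ∈ Z, x ≠ y → 1 - η ≤ dist x y) → ∀ z ∈ Z, ∀ z' ∈ Z, z ≠ z' →
      dist z z' ≤ 1 + η → {w ∈ Z | w ≠ z ∧ dist w z ≤ 1 + η}.ncard = 12 →
      {w ∈ Z | w ≠ z' ∧ dist w z' ≤ 1 + η}.ncard = 12 →
      {w ∈ Z | w ≠ z ∧ w ≠ z' ∧ (dist w z ≤ 1 + η ∨ dist w z' ≤ 1 + η)}.ncard ≤ 18 := by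
  unfold SoftTwoCentreFourCommon
  constructor
  · intro h η hη hη1 Z hsep z hz z' hz' hne hd hN hN'
    have h4 := h η hη hη1 Z hsep z hz z' hz' hne hd hN hN'
    have h22 := softTwoCentre_common_add_dimer_eq hz hz' hne hd hN hN'
    omega
  · intro h η hη hη1 Z hsep z hz z' hz' hne hd hN hN'
    have h18 := h η hη hη1 Z hsep z hz z' hz' hne hd hN hN'
    have h22 := softTwoCentre_common_add_dimer_eq hz hz' hne hd hN hN'
    omega

/-- **The soft dimer-kissing bound implies `SoftTwoCentreFourCommon`.**  If, for every tolerance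
`η ∈ [0, 10⁻³]`, every `(1-η)`-separated `Z ⊆ ℝ³` and every pair `z ≠ z'` of points of `Z` within
`1 + η` of each other, at most `18` further points of `Z` lie within `1 + η` of `z` or of `z'`
(a soft "kissing number of the unit dimer is `18`"; NO twelve-coordination hypothesis — the set in
question is finite by separation, so `Set.ncard` is the honest count), then the soft two-centre
lemma holds.  This pure packing bound is a stronger, hypothesis-free certificate target
(numerically: 19 balls on a unit dimer force min-distance ratio ≈ 0.9903 < 0.998, kit j016614). -/
theorem softTwoCentreFourCommon_of_dimerKissing
    (H : ∀ η : ℝ, 0 ≤ η → η ≤ 1 / 1000 → ∀ Z : Set (EuclideanSpace ℝ (Fin 3)),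
      (∀ x ∈ Z, ∀ y ∈ Z, x ≠ y → 1 - η ≤ dist x y) → ∀ z ∈ Z, ∀ z' ∈ Z, z ≠ z' →
      dist z z' ≤ 1 + η →
      {w ∈ Z | w ≠ z ∧ w ≠ z' ∧ (dist w z ≤ 1 + η ∨ dist w z' ≤ 1 + η)}.ncard ≤ 18) :
    SoftTwoCentreFourCommon :=
  softTwoCentreFourCommon_iff_dimer.2 fun η hη hη1 Z hsep z hz z' hz' hne hd _ _ =>
    H η hη hη1 Z hsep z hz z' hz' hne hd

/-- **Nineteen-point certificate form.**  `SoftTwoCentreFourCommon` follows from the purely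
finite statement: for no tolerance `η ∈ [0, 10⁻³]` are there two centres `z, z'` with
`1 - η ≤ dist z z' ≤ 1 + η` and `19` points, pairwise `(1-η)`-separated, each at distance `≥ 1 - η`
from both centres and within `1 + η` of at least one of them ("19 balls never touch a unit dimer",
soft form; `19 + 2` points, a compact configuration space of dimension `≤ 57`).  Proof: if more
than `18` further points of `Z` lay on the dimer, any `19` of them would be such a configuration;
conclude by `softTwoCentreFourCommon_of_dimerKissing`. -/
theorem softTwoCentreFourCommon_of_no_nineteen
    (H : ∀ η : ℝ, 0 ≤ η → η ≤ 1 / 1000 → ∀ (z z' : EuclideanSpace ℝ (Fin 3))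
      (F : Finset (EuclideanSpace ℝ (Fin 3))), F.card = 19 →
      1 - η ≤ dist z z' → dist z z' ≤ 1 + η →
      (∀ w ∈ F, 1 - η ≤ dist w z ∧ 1 - η ≤ dist w z' ∧
        (dist w z ≤ 1 + η ∨ dist w z' ≤ 1 + η)) →
      (∀ x ∈ F, ∀ y ∈ F, x ≠ y → 1 - η ≤ dist x y) → False) :
    SoftTwoCentreFourCommon := by
  refine softTwoCentreFourCommon_of_dimerKissing ?_
  intro η hη hη1 Z hsep z hz z' hz' hne hd
  by_contra hlt
  rw [not_le] at hlt
  obtain ⟨t, htU, htcard⟩ := Set.exists_subset_card_eq (s :=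
    {w ∈ Z | w ≠ z ∧ w ≠ z' ∧ (dist w z ≤ 1 + η ∨ dist w z' ≤ 1 + η)}) (n := 19) hlt
  have htfin : t.Finite := Set.finite_of_ncard_ne_zero (by rw [htcard]; norm_num)
  refine H η hη hη1 z z' htfin.toFinset ?_ (hsep z hz z' hz' hne) hd ?_ ?_
  · rw [← Set.ncard_eq_toFinset_card t htfin]; exact htcard
  · intro w hw
    rw [Set.Finite.mem_toFinset] at hw
    obtain ⟨hwZ, hwz, hwz', hor⟩ := htU hw
    exact ⟨hsep w hwZ z hz hwz, hsep w hwZ z' hz' hwz', hor⟩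
  · intro x hx y hy hxy
    rw [Set.Finite.mem_toFinset] at hx hy
    exact hsep x (htU hx).1 y (htU hy).1 hxy

end Summit.AtomisticToContinuum.Crystallization.Theorems
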